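import Mathlib
import Literature.Topology.PlaneTopology.ArgumentIncrement
import Literature.Probability.RandomPlanarGeometry.LoopWinding
import Summits.CriticalPhenomena.CardyFormulaZ2.Theorems.CardyMagicRigidityNestingRigidityTreeRigidityNeedleLoops
import HarnessLib

/-!
# `tame_rigidity` is false, I: circular arcs, and the two-mouth-lake loop with its winding function

Crux `Summit.CriticalPhenomena.CardyFormulaZ2.Theses.CardyMagicRigidity.NestingRigidity`
(stmt-CriticalPhenomena-4835), line `positive-cone-weight-doubling`, registered helper `tame_rigidity`
(`∀ u v, Tame u → Tame v → (∀ z, u.wind z = v.wind z) → u = v`, vocabulary of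
`Theorems/CardyMagicRigidityPositiveConeJointDefs.lean`).  That statement is FALSE; this is the first of three
files formalising the witness.  Here: circular arcs `t ↦ circleMap c r (θ₀ + (θ₁ − θ₀) t)` as Mathlib paths
(`TwoMouth.exists_arc`; entered, as the lobes of `…TreeRigidityNeedleLoops`, through a hypothesis `hγ` on an
abstract `γ : Path p q`), the winding number of a full circle traversed `n = ±1` times
(`TwoMouth.wind_ofPath_arc`), and the loop

  `U · D · d · b · a · c : Path 2 2`  (Mathlib `(U.trans D).trans ((d.trans b).trans (a.trans c))`),

`U`/`D` the upper/lower halves of the circle `|z| = 2` (anticlockwise), `a`/`b` the upper/lower halves of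
`|z + 1| = 1` and `c`/`d` those of `|z - 1| = 1` (both clockwise): an Eulerian circuit of the oriented 1-cycle
`∂B(0,2) − ∂B(−1,1) − ∂B(1,1)` visiting each of the tangency points `−2, 0, 2` twice.  Its trace is the union of
the three circles (`TwoMouth.range_loop`) and its winding number is, EVERYWHERE,
`W = 𝟙[|z| < 2 ∧ |z + 1| > 1 ∧ |z − 1| > 1]` (`TwoMouth.wind_loop`: additivity of the argument increment
`Path.argInc` over the six arcs, regrouped circle by circle).  Anchor: `exists_twoMouthLoop`.
-/

noncomputable section

open Set Metric Complex
open scoped Real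

namespace Summit.CriticalPhenomena.CardyFormulaZ2.Cruxes.NestingRigidity.PositiveConeWeightDoubling

open Literature.Probability.RandomPlanarGeometry
open Literature.Topology.PlaneTopology (int_eq_of_mul_two_pi_I_eq)
open NeedleLoops (argInc_eq_wind_ofPath_mul isLoop_ofPath)

namespace TwoMouth

/-! ## §1 Circular arcs as paths -/

/-- **Arcs.**  The circular arc of centre `c`, radius `r`, from angle `θ₀` to angle `θ₁` at constant angular
speed, `t ↦ circleMap c r (θ₀ + (θ₁ − θ₀) t)`, as a Mathlib path between its end points.  Below, an *arc* is
any `γ : Path p q` with this formula (`hγ`). -/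
theorem exists_arc (c : ℂ) (r θ₀ θ₁ : ℝ) {p q : ℂ} (hp : circleMap c r θ₀ = p) (hq : circleMap c r θ₁ = q) :
    ∃ γ : Path p q, ∀ t, γ t = circleMap c r (θ₀ + (θ₁ - θ₀) * t) :=
  ⟨{ toFun := fun t ↦ circleMap c r (θ₀ + (θ₁ - θ₀) * t)
     continuous_toFun := (continuous_circleMap c r).comp (by fun_prop)
     source' := by simpa using hp
     target' := by simpa using hq }, fun _ ↦ rfl⟩

/-- An arc stays on its circle. -/
theorem range_arc_subset {c : ℂ} {r : ℝ} (hr : 0 ≤ r) {θ₀ θ₁ : ℝ} {p q : ℂ} {γ : Path p q}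
    (hγ : ∀ t, γ t = circleMap c r (θ₀ + (θ₁ - θ₀) * t)) : Set.range γ ⊆ sphere c r := by
  rintro _ ⟨t, rfl⟩
  rw [hγ]
  exact circleMap_mem_sphere c hr _

/-- A point off the circle is off every arc of it. -/
theorem not_mem_range_arc {c : ℂ} {r : ℝ} (hr : 0 ≤ r) {θ₀ θ₁ : ℝ} {p q : ℂ} {γ : Path p q}
    (hγ : ∀ t, γ t = circleMap c r (θ₀ + (θ₁ - θ₀) * t)) {z : ℂ} (hz : dist z c ≠ r) : z ∉ Set.range γ :=
  fun h ↦ hz (mem_sphere.1 (range_arc_subset hr hγ h))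

/-- **Concatenating two consecutive arcs of equal angular span gives the arc** (pointwise). -/
theorem trans_arc {c : ℂ} {r θ₀ θ₁ θ₂ : ℝ} {p q s : ℂ} {γ₁ : Path p q} {γ₂ : Path q s}
    (h₁ : ∀ t, γ₁ t = circleMap c r (θ₀ + (θ₁ - θ₀) * t)) (h₂ : ∀ t, γ₂ t = circleMap c r (θ₁ + (θ₂ - θ₁) * t))
    (h : θ₁ - θ₀ = θ₂ - θ₁) (t : unitInterval) : (γ₁.trans γ₂) t = circleMap c r (θ₀ + (θ₂ - θ₀) * t) := by
  obtain rfl : θ₂ = 2 * θ₁ - θ₀ := by linarith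
  rw [Path.trans_apply]
  split_ifs with ht
  · rw [h₁]
    congr 1
    ring
  · rw [h₂]
    congr 1
    ring

/-- A full circle (angular span `±2π`) has trace the whole circle. -/
theorem range_arc_of_span {c : ℂ} {r : ℝ} (hr : 0 < r) {θ₀ θ₁ : ℝ} {p q : ℂ} {γ : Path p q}
    (hγ : ∀ t, γ t = circleMap c r (θ₀ + (θ₁ - θ₀) * t)) (h : θ₁ - θ₀ = 2 * π ∨ θ₁ - θ₀ = -(2 * π)) :
    Set.range γ = sphere c r := by
  refine Subset.antisymm (range_arc_subset hr.le hγ) fun w hw ↦ ?_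
  have hw' : w ∈ Set.range (circleMap c r) := by rw [range_circleMap, abs_of_pos hr]; exact hw
  obtain ⟨θ, rfl⟩ := hw'
  -- the parameter `t = fract ((θ - θ₀)/(θ₁ - θ₀))`
  set N : ℤ := ⌊(θ - θ₀) / (θ₁ - θ₀)⌋ with hN
  set t : ℝ := Int.fract ((θ - θ₀) / (θ₁ - θ₀)) with ht
  have ht01 : t ∈ Icc (0 : ℝ) 1 := ⟨Int.fract_nonneg _, (Int.fract_lt_one _).le⟩
  refine ⟨⟨t, ht01⟩, ?_⟩
  rw [hγ, Subtype.coe_mk]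
  have h2π : (2 * π : ℝ) ≠ 0 := by positivity
  have hne : θ₁ - θ₀ ≠ 0 := by
    rcases h with h | h <;> rw [h]
    exacts [h2π, neg_ne_zero.2 h2π]
  have key : θ₀ + (θ₁ - θ₀) * t = θ + (-(N * ((θ₁ - θ₀) / (2 * π)))) * (2 * π) := by
    rw [ht, Int.fract, ← hN]
    field_simp
    ring
  rw [key]
  rcases h with h | h
  · rw [h, div_self h2π, mul_one]
    have := (periodic_circleMap c r).int_mul (-N) θ
    push_cast at this
    exact this
  · rw [h, neg_div, div_self h2π, mul_neg, mul_one, neg_neg]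
    exact (periodic_circleMap c r).int_mul N θ

/-! ## §2 The winding number of a full circle -/

/-- **Winding number of a circle traversed `n` times** (`n = ±1` below): `n` inside, `0` outside.  Inside:
the explicit logarithm `log r + i(θ₀ + (θ₁ − θ₀)t)` at the centre, then Rouché (`wind_eq_of_norm_sub_lt`);
outside: the trace lies in a ball missing the point. -/
theorem wind_ofPath_arc {c : ℂ} {r : ℝ} (hr : 0 < r) {θ₀ θ₁ : ℝ} {p : ℂ} {γ : Path p p}
    (hγ : ∀ t, γ t = circleMap c r (θ₀ + (θ₁ - θ₀) * t)) {n : ℤ} (hn : θ₁ - θ₀ = n * (2 * π)) {z : ℂ}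
    (hz : dist z c ≠ r) : (Curve.ofPath γ).wind z = if dist z c < r then n else 0 := by
  have hloop := isLoop_ofPath γ
  have hsub : ∀ t : unitInterval, Curve.ofPath γ t - c = r * exp ((θ₀ + (θ₁ - θ₀) * (t : ℝ) : ℝ) * I) :=
    fun t ↦ by rw [Curve.ofPath_apply, hγ, circleMap_sub_center, circleMap_zero]
  have hcenter : (Curve.ofPath γ).wind c = n := by
    refine Curve.wind_eq_of_log hloop (l := fun t ↦ (Real.log r : ℂ) + (θ₀ + (θ₁ - θ₀) * t) * I)
      (by fun_prop) (fun t ht ↦ ?_) ?_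
    · rw [exp_add, ← ofReal_exp, Real.exp_log hr, hsub ⟨t, ht⟩]
      push_cast
      ring_nf
    · push_cast
      rw [show (θ₁ : ℂ) = θ₀ + n * (2 * π) by exact_mod_cast (sub_eq_iff_eq_add'.1 hn)]
      ring
  split_ifs with h
  · rw [← hcenter]
    have hc : c ∉ (Curve.ofPath γ).range := fun ⟨t, ht⟩ ↦ by
      have := congrArg (fun w ↦ ‖w - c‖) ht
      simp only [hsub t, sub_self, norm_zero, Complex.norm_mul, norm_real, Real.norm_eq_abs,
        abs_of_pos hr, norm_exp_ofReal_mul_I, mul_one] at this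
      exact hr.ne' this
    refine Literature.Topology.PlaneTopology.wind_eq_of_norm_sub_lt
      (Curve.continuous_subPt _ z).continuousOn (Curve.subPt_zero_eq_one hloop z)
      (Curve.isNonvanishingLoop_subPt hloop hc) fun t ht ↦ ?_
    rw [Curve.subPt_of_mem _ _ ht, Curve.subPt_of_mem _ _ ht, sub_sub_sub_cancel_left, hsub ⟨t, ht⟩,
      Complex.norm_mul, norm_real, Real.norm_eq_abs, abs_of_pos hr, norm_exp_ofReal_mul_I, mul_one,
      ← dist_eq_norm, dist_comm]
    exact h
  · refine Curve.wind_eq_zero_of_subset_ball (w := c) (ρ := dist z c) ?_ le_rfl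
    rintro _ ⟨t, rfl⟩
    rw [mem_ball, dist_eq_norm, hsub t, Complex.norm_mul, norm_real, Real.norm_eq_abs, abs_of_pos hr,
      norm_exp_ofReal_mul_I, mul_one]
    exact lt_of_le_of_ne (not_lt.1 h) (Ne.symm hz)

/-! ## §3 The two-mouth-lake loop `U · D · d · b · a · c` -/

/-- `circleMap 0 2 0 = 2`. -/
theorem cm_big_zero : circleMap 0 2 0 = 2 := by simp [circleMap]

/-- `circleMap 0 2 π = -2`. -/
theorem cm_big_pi : circleMap 0 2 π = -2 := by simp [circleMap, exp_pi_mul_I]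

/-- `circleMap 0 2 (2π) = 2`. -/
theorem cm_big_two_pi : circleMap 0 2 (2 * π) = 2 := by simp [circleMap]

/-- `circleMap 1 1 π = 0`. -/
theorem cm_right_pi : circleMap 1 1 π = 0 := by simp [circleMap, exp_pi_mul_I]

/-- `circleMap 1 1 0 = 2`. -/
theorem cm_right_zero : circleMap 1 1 0 = 2 := by simp [circleMap]; norm_num

/-- `circleMap 1 1 (-π) = 0`. -/
theorem cm_right_neg_pi : circleMap 1 1 (-π) = 0 := by simp [circleMap, exp_neg, exp_pi_mul_I]

/-- `circleMap (-1) 1 π = -2`. -/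
theorem cm_left_pi : circleMap (-1) 1 π = -2 := by simp [circleMap, exp_pi_mul_I]; norm_num

/-- `circleMap (-1) 1 0 = 0`. -/
theorem cm_left_zero : circleMap (-1) 1 0 = 0 := by simp [circleMap]

/-- `circleMap (-1) 1 (-π) = -2`. -/
theorem cm_left_neg_pi : circleMap (-1) 1 (-π) = -2 := by
  simp [circleMap, exp_neg, exp_pi_mul_I]; norm_num

/-- **The six arcs exist**: `U`/`D` the upper/lower halves of `|z| = 2` (anticlockwise, `2 → −2 → 2`),
`a`/`b` the upper/lower halves of `|z + 1| = 1` (clockwise, `−2 → 0 → −2`), `c`/`d` the upper/lower halves of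
`|z − 1| = 1` (clockwise, `0 → 2 → 0`), each at constant angular speed. -/
theorem exists_arcs : ∃ (U : Path (2 : ℂ) (-2)) (D : Path (-2 : ℂ) 2) (a : Path (-2 : ℂ) 0)
    (b : Path (0 : ℂ) (-2)) (c : Path (0 : ℂ) 2) (d : Path (2 : ℂ) 0),
    (∀ t, U t = circleMap 0 2 (0 + (π - 0) * t)) ∧ (∀ t, D t = circleMap 0 2 (π + (2 * π - π) * t)) ∧
    (∀ t, a t = circleMap (-1) 1 (π + (0 - π) * t)) ∧ (∀ t, b t = circleMap (-1) 1 (0 + (-π - 0) * t)) ∧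
    (∀ t, c t = circleMap 1 1 (π + (0 - π) * t)) ∧ (∀ t, d t = circleMap 1 1 (0 + (-π - 0) * t)) := by
  obtain ⟨U, hU⟩ := exists_arc 0 2 0 π cm_big_zero cm_big_pi
  obtain ⟨D, hD⟩ := exists_arc 0 2 π (2 * π) cm_big_pi cm_big_two_pi
  obtain ⟨a, ha⟩ := exists_arc (-1) 1 π 0 cm_left_pi cm_left_zero
  obtain ⟨b, hb⟩ := exists_arc (-1) 1 0 (-π) cm_left_zero cm_left_neg_pi
  obtain ⟨c, hc⟩ := exists_arc 1 1 π 0 cm_right_pi cm_right_zero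
  obtain ⟨d, hd⟩ := exists_arc 1 1 0 (-π) cm_right_zero cm_right_neg_pi
  exact ⟨U, D, a, b, c, d, hU, hD, ha, hb, hc, hd⟩

section Loop

variable {U : Path (2 : ℂ) (-2)} {D : Path (-2 : ℂ) 2} {a : Path (-2 : ℂ) 0} {b : Path (0 : ℂ) (-2)}
  {c : Path (0 : ℂ) 2} {d : Path (2 : ℂ) 0}

/-- `U · D` is the full circle `|z| = 2` anticlockwise. -/
theorem trans_big (hU : ∀ t, U t = circleMap 0 2 (0 + (π - 0) * t))
    (hD : ∀ t, D t = circleMap 0 2 (π + (2 * π - π) * t)) (t : unitInterval) :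
    (U.trans D) t = circleMap 0 2 (0 + (2 * π - 0) * t) :=
  trans_arc hU hD (by ring) t

/-- `a · b` is the full circle `|z + 1| = 1` clockwise. -/
theorem trans_left (ha : ∀ t, a t = circleMap (-1) 1 (π + (0 - π) * t))
    (hb : ∀ t, b t = circleMap (-1) 1 (0 + (-π - 0) * t)) (t : unitInterval) :
    (a.trans b) t = circleMap (-1) 1 (π + (-π - π) * t) :=
  trans_arc ha hb (by ring) t

/-- `c · d` is the full circle `|z - 1| = 1` clockwise. -/
theorem trans_right (hc : ∀ t, c t = circleMap 1 1 (π + (0 - π) * t))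
    (hd : ∀ t, d t = circleMap 1 1 (0 + (-π - 0) * t)) (t : unitInterval) :
    (c.trans d) t = circleMap 1 1 (π + (-π - π) * t) :=
  trans_arc hc hd (by ring) t

/-- **The trace of the loop `U · D · d · b · a · c` is the union of the three circles.** -/
theorem range_loop (hU : ∀ t, U t = circleMap 0 2 (0 + (π - 0) * t))
    (hD : ∀ t, D t = circleMap 0 2 (π + (2 * π - π) * t)) (ha : ∀ t, a t = circleMap (-1) 1 (π + (0 - π) * t))
    (hb : ∀ t, b t = circleMap (-1) 1 (0 + (-π - 0) * t)) (hc : ∀ t, c t = circleMap 1 1 (π + (0 - π) * t))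
    (hd : ∀ t, d t = circleMap 1 1 (0 + (-π - 0) * t)) :
    Set.range ((U.trans D).trans ((d.trans b).trans (a.trans c))) = sphere 0 2 ∪ sphere (-1) 1 ∪ sphere 1 1 := by
  have h1 : Set.range U ∪ Set.range D = sphere 0 2 := by
    rw [← Path.trans_range, range_arc_of_span two_pos (trans_big hU hD) (Or.inl (by ring))]
  have h2 : Set.range a ∪ Set.range b = sphere (-1) 1 := by
    rw [← Path.trans_range, range_arc_of_span one_pos (trans_left ha hb) (Or.inr (by ring))]
  have h3 : Set.range c ∪ Set.range d = sphere 1 1 := by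
    rw [← Path.trans_range, range_arc_of_span one_pos (trans_right hc hd) (Or.inr (by ring))]
  rw [Path.trans_range, Path.trans_range, Path.trans_range, Path.trans_range, Path.trans_range, ← h1, ← h2,
    ← h3]
  ext w
  simp only [mem_union]
  tauto

/-- **Winding number of the loop off the three circles**: `𝟙[|z| < 2] − 𝟙[|z+1| < 1] − 𝟙[|z−1| < 1]`
(additivity of `Path.argInc` over the six arcs, regrouped circle by circle, and `wind_ofPath_arc`). -/
theorem wind_loop_of_not_mem (hU : ∀ t, U t = circleMap 0 2 (0 + (π - 0) * t))
    (hD : ∀ t, D t = circleMap 0 2 (π + (2 * π - π) * t)) (ha : ∀ t, a t = circleMap (-1) 1 (π + (0 - π) * t))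
    (hb : ∀ t, b t = circleMap (-1) 1 (0 + (-π - 0) * t)) (hc : ∀ t, c t = circleMap 1 1 (π + (0 - π) * t))
    (hd : ∀ t, d t = circleMap 1 1 (0 + (-π - 0) * t)) {z : ℂ} (h0 : dist z 0 ≠ 2) (hl : dist z (-1) ≠ 1)
    (hr : dist z 1 ≠ 1) :
    (Curve.ofPath ((U.trans D).trans ((d.trans b).trans (a.trans c)))).wind z =
      (if dist z 0 < 2 then 1 else 0) + (if dist z (-1) < 1 then -1 else 0) + (if dist z 1 < 1 then -1 else 0) := by
  have nU : z ∉ Set.range U := not_mem_range_arc zero_le_two hU h0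
  have nD : z ∉ Set.range D := not_mem_range_arc zero_le_two hD h0
  have na : z ∉ Set.range a := not_mem_range_arc zero_le_one ha hl
  have nb : z ∉ Set.range b := not_mem_range_arc zero_le_one hb hl
  have nc : z ∉ Set.range c := not_mem_range_arc zero_le_one hc hr
  have nd : z ∉ Set.range d := not_mem_range_arc zero_le_one hd hr
  have nUD : z ∉ Set.range (U.trans D) := by rw [Path.trans_range]; rintro (h | h); exacts [nU h, nD h]
  have ndb : z ∉ Set.range (d.trans b) := by rw [Path.trans_range]; rintro (h | h); exacts [nd h, nb h]
  have nac : z ∉ Set.range (a.trans c) := by rw [Path.trans_range]; rintro (h | h); exacts [na h, nc h]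
  have nrest : z ∉ Set.range ((d.trans b).trans (a.trans c)) := by
    rw [Path.trans_range]; rintro (h | h); exacts [ndb h, nac h]
  have nloop : z ∉ Set.range ((U.trans D).trans ((d.trans b).trans (a.trans c))) := by
    rw [Path.trans_range]; rintro (h | h); exacts [nUD h, nrest h]
  have key : ((U.trans D).trans ((d.trans b).trans (a.trans c))).argInc z =
      U.argInc z + D.argInc z + (d.argInc z + b.argInc z + (a.argInc z + c.argInc z)) := by
    rw [Path.argInc_trans _ _ nUD nrest, Path.argInc_trans _ _ nU nD, Path.argInc_trans _ _ ndb nac,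
      Path.argInc_trans _ _ nd nb, Path.argInc_trans _ _ na nc]
  have eL := argInc_eq_wind_ofPath_mul _ nloop
  have eB : U.argInc z + D.argInc z = ((if dist z 0 < 2 then 1 else 0 : ℤ) : ℂ) * (2 * π * I) := by
    rw [← Path.argInc_trans _ _ nU nD, argInc_eq_wind_ofPath_mul _ nUD,
      wind_ofPath_arc two_pos (trans_big hU hD) (n := 1) (by ring) h0]
  have e1 : a.argInc z + b.argInc z = ((if dist z (-1) < 1 then -1 else 0 : ℤ) : ℂ) * (2 * π * I) := by
    have nab : z ∉ Set.range (a.trans b) := by rw [Path.trans_range]; rintro (h | h); exacts [na h, nb h]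
    rw [← Path.argInc_trans _ _ na nb, argInc_eq_wind_ofPath_mul _ nab,
      wind_ofPath_arc one_pos (trans_left ha hb) (n := -1) (by ring) hl]
  have e2 : c.argInc z + d.argInc z = ((if dist z 1 < 1 then -1 else 0 : ℤ) : ℂ) * (2 * π * I) := by
    have ncd : z ∉ Set.range (c.trans d) := by rw [Path.trans_range]; rintro (h | h); exacts [nc h, nd h]
    rw [← Path.argInc_trans _ _ nc nd, argInc_eq_wind_ofPath_mul _ ncd,
      wind_ofPath_arc one_pos (trans_right hc hd) (n := -1) (by ring) hr]
  apply int_eq_of_mul_two_pi_I_eq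
  rw [Int.cast_add, Int.cast_add, add_mul, add_mul, ← eL, ← eB, ← e1, ← e2, key]
  ring

/-- **The winding function of the two-mouth-lake loop, everywhere**:
`W = 𝟙[|z| < 2 ∧ |z + 1| > 1 ∧ |z − 1| > 1]` (junk `0` on the trace included). -/
theorem wind_loop (hU : ∀ t, U t = circleMap 0 2 (0 + (π - 0) * t))
    (hD : ∀ t, D t = circleMap 0 2 (π + (2 * π - π) * t)) (ha : ∀ t, a t = circleMap (-1) 1 (π + (0 - π) * t))
    (hb : ∀ t, b t = circleMap (-1) 1 (0 + (-π - 0) * t)) (hc : ∀ t, c t = circleMap 1 1 (π + (0 - π) * t))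
    (hd : ∀ t, d t = circleMap 1 1 (0 + (-π - 0) * t)) (z : ℂ) :
    (Curve.ofPath ((U.trans D).trans ((d.trans b).trans (a.trans c)))).wind z =
      if ‖z‖ < 2 ∧ 1 < ‖z + 1‖ ∧ 1 < ‖z - 1‖ then 1 else 0 := by
  have d0 : dist z 0 = ‖z‖ := dist_zero_right z
  have dl : dist z (-1) = ‖z + 1‖ := by rw [dist_eq_norm, sub_neg_eq_add]
  have dr : dist z 1 = ‖z - 1‖ := dist_eq_norm z 1
  by_cases hT : dist z 0 = 2 ∨ dist z (-1) = 1 ∨ dist z 1 = 1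
  · have hz : z ∈ (Curve.ofPath ((U.trans D).trans ((d.trans b).trans (a.trans c)))).range := by
      rw [show (Curve.ofPath ((U.trans D).trans ((d.trans b).trans (a.trans c)))).range =
        Set.range ((U.trans D).trans ((d.trans b).trans (a.trans c))) from rfl, range_loop hU hD ha hb hc hd]
      simp only [mem_union, mem_sphere]
      tauto
    rw [Curve.wind_of_mem_range hz, if_neg]
    rw [← d0, ← dl, ← dr]
    rintro ⟨h₁, h₂, h₃⟩
    rcases hT with h | h | h <;> linarith
  push Not at hT
  rw [wind_loop_of_not_mem hU hD ha hb hc hd hT.1 hT.2.1 hT.2.2, d0, dl, dr]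
  -- `|z + 1| < 1` forces `|z| < 2` and `|z - 1| > 1`, and symmetrically
  have tl : ‖z + 1‖ < 1 → ‖z‖ < 2 ∧ ¬ ‖z - 1‖ < 1 := fun h ↦ by
    constructor
    · calc ‖z‖ = ‖(z + 1) - 1‖ := by ring_nf
        _ ≤ ‖z + 1‖ + ‖(1 : ℂ)‖ := norm_sub_le _ _
        _ < 2 := by rw [norm_one]; linarith
    · have : (2 : ℝ) ≤ ‖z + 1‖ + ‖z - 1‖ := by
        calc (2 : ℝ) = ‖(z + 1) - (z - 1)‖ := by norm_num
          _ ≤ ‖z + 1‖ + ‖z - 1‖ := norm_sub_le _ _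
      intro h'; linarith
  have tr : ‖z - 1‖ < 1 → ‖z‖ < 2 ∧ ¬ ‖z + 1‖ < 1 := fun h ↦ by
    constructor
    · calc ‖z‖ = ‖(z - 1) + 1‖ := by ring_nf
        _ ≤ ‖z - 1‖ + ‖(1 : ℂ)‖ := norm_add_le _ _
        _ < 2 := by rw [norm_one]; linarith
    · exact fun h' ↦ (tl h').2 h
  have el : ‖z + 1‖ ≠ 1 := by rw [← dl]; exact hT.2.1
  have er : ‖z - 1‖ ≠ 1 := by rw [← dr]; exact hT.2.2
  by_cases hl1 : ‖z + 1‖ < 1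
  · obtain ⟨h₀, h₂⟩ := tl hl1
    rw [if_pos h₀, if_pos hl1, if_neg h₂, if_neg (fun h ↦ (not_lt.2 h.2.1.le) hl1)]
    norm_num
  by_cases hr1 : ‖z - 1‖ < 1
  · obtain ⟨h₀, -⟩ := tr hr1
    rw [if_pos h₀, if_neg hl1, if_pos hr1, if_neg (fun h ↦ (not_lt.2 h.2.2.le) hr1)]
    norm_num
  have hl1' : 1 < ‖z + 1‖ := lt_of_le_of_ne (not_lt.1 hl1) (Ne.symm el)
  have hr1' : 1 < ‖z - 1‖ := lt_of_le_of_ne (not_lt.1 hr1) (Ne.symm er)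
  by_cases h₀ : ‖z‖ < 2
  · rw [if_pos h₀, if_neg hl1, if_neg hr1, if_pos ⟨h₀, hl1', hr1'⟩]; norm_num
  · rw [if_neg h₀, if_neg hl1, if_neg hr1, if_neg (fun h ↦ h₀ h.1)]; norm_num

end Loop

end TwoMouth

/-- **Anchor (registered): the two-mouth-lake loop exists** — a Mathlib loop `γ : Path 2 2` whose trace is
the union of the circles `|z| = 2`, `|z + 1| = 1`, `|z - 1| = 1` and whose winding number, read as a tree curve,
is everywhere `𝟙[|z| < 2 ∧ |z + 1| > 1 ∧ |z - 1| > 1]` (witness `U · D · d · b · a · c`, `TwoMouth.exists_arcs`;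
first brick of the refutation of `tame_rigidity`). -/
theorem exists_twoMouthLoop : ∃ γ : Path (2 : ℂ) 2,
    Set.range γ = Metric.sphere 0 2 ∪ Metric.sphere (-1) 1 ∪ Metric.sphere 1 1 ∧
      ∀ z, (Curve.ofPath γ).wind z = if ‖z‖ < 2 ∧ 1 < ‖z + 1‖ ∧ 1 < ‖z - 1‖ then 1 else 0 := by
  obtain ⟨U, D, a, b, c, d, hU, hD, ha, hb, hc, hd⟩ := TwoMouth.exists_arcs
  exact ⟨_, TwoMouth.range_loop hU hD ha hb hc hd, TwoMouth.wind_loop hU hD ha hb hc hd⟩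

end Summit.CriticalPhenomena.CardyFormulaZ2.Cruxes.NestingRigidity.PositiveConeWeightDoubling

end
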